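import Literature.NumberTheory.Transcendental.ZudilinOddZetaComplex
import Literature.Analysis.Complex.SecondDerivativeSummation
import HarnessLib

/-!
# Zudilin's linear forms `Sₙ` as Barnes-type line integrals

Topic `Literature/NumberTheory/Transcendental`; continues `ZudilinOddZetaComplex.lean`.
Everything here is PROVED; no new definitions, no named facts.

For `n ≥ 1` and any integer `0 ≤ m ≤ 27n` (so that the line `re k = m + ½` runs inside the block
`k = 1, …, 27n` of triple zeros of `Rₙ`), Zudilin's linear form
`Sₙ = ½ Σ_{k ≥ 1} Rₙ''(k)` (`Literature.NumberTheory.Transcendental.Zudilin2004.S`, a real series) is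

  `Sₙ = Re [ (iπ²/2) ∫_{−∞}^{∞} Rₙ(m + ½ + iy) sinh(πy)/cosh³(πy) dy ]`   (`S_eq_re_integral`),

the Barnes-integral representation `F = (1/2πi) ∫ R(t) π³cos(πt)/sin³(πt) dt` of
[Zudilin2002, §4 Lemma 2] (`b = 3`) / [Zudilin2004, (8.4)–(8.6)] (`r = 3`) specialised to a
half-integer line, on which the kernel `π³ cos/sin³` becomes `−iπ³ sinh(πy)/cosh³(πy)`. This is the
input of the saddle-point analysis ([Zudilin2004, Lemma 20]) of the analytic half of the proof that
one of `ζ(5), ζ(7), ζ(9), ζ(11)` is irrational.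

Steps: the real and complex second derivatives of `Rₙ` agree on the real axis
(`iteratedDeriv_two_R_real`); `Rₙ''` vanishes at `k = 1, …, 27n` (`iteratedDeriv_two_R_eq_zero`);
the series converges absolutely (`summable_iteratedDeriv_two_R`); and the tail from `m + 1` on is
the line integral (`Literature.Analysis.Complex.hasSum_iteratedDeriv_two_div_two_halfInt`, from the
cotangent summation formula and two integrations by parts).

## References

* [Zudilin2004] W. Zudilin, *Arithmetic of linear forms involving odd zeta values*, J. Théor.
  Nombres Bordeaux 16 (2004), 251–291, §8 ((8.4)–(8.6), Lemma 20).
* [Zudilin2002] W. Zudilin, *Irrationality of values of the Riemann zeta function*, Izv. Math. 66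
  (2002), 489–542 (arXiv:math/0104249), §4, Lemma 2.
-/

noncomputable section

open Finset Complex Filter
open scoped Topology Real

namespace Literature.NumberTheory.Transcendental

namespace Zudilin2004

/-- The open half-plane `{re k > −1/2}` on which `Rₙ` is holomorphic. [folklore] -/
theorem isOpen_halfPlane : IsOpen {k : ℂ | -1 / 2 < k.re} :=
  isOpen_lt continuous_const Complex.continuous_re

/-! ### Real and complex derivatives of `Rₙ` agree on the real axis -/

/-- The real function `Rₙ` is differentiable at `x > −1/2` with derivative `Re (Rₙ)'(x)` (complex
derivative). [folklore] -/
theorem hasDerivAt_R_real {n : ℕ} (hn : 1 ≤ n) {x : ℝ} (hx : -1 / 2 < x) :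
    HasDerivAt (R n : ℝ → ℝ) (deriv (R n : ℂ → ℂ) x).re x := by
  have hc : HasDerivAt (R n : ℂ → ℂ) (deriv (R n : ℂ → ℂ) x) (x : ℂ) :=
    ((differentiableOn_R hn).differentiableAt (isOpen_halfPlane.mem_nhds (by simpa using hx))).hasDerivAt
  refine hc.real_of_complex.congr_of_eventuallyEq (Eventually.of_forall fun t ↦ ?_)
  simp only
  rw [← ofReal_R, Complex.ofReal_re]

/-- `Rₙ''(x)` (real) `= Re Rₙ''(x)` (complex) for real `x > −1/2`. [folklore] -/
theorem iteratedDeriv_two_R_real {n : ℕ} (hn : 1 ≤ n) {x : ℝ} (hx : -1 / 2 < x) :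
    iteratedDeriv 2 (R n : ℝ → ℝ) x = (iteratedDeriv 2 (R n : ℂ → ℂ) x).re := by
  rw [iteratedDeriv_succ, iteratedDeriv_one, iteratedDeriv_succ, iteratedDeriv_one]
  have hev : deriv (R n : ℝ → ℝ) =ᶠ[𝓝 x] fun t : ℝ ↦ (deriv (R n : ℂ → ℂ) t).re := by
    filter_upwards [Ioi_mem_nhds hx] with t ht using (hasDerivAt_R_real hn ht).deriv
  rw [hev.deriv_eq]
  have hdiff : DifferentiableOn ℂ (deriv (R n : ℂ → ℂ)) {k : ℂ | -1 / 2 < k.re} :=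
    (differentiableOn_R hn).deriv isOpen_halfPlane
  have hd : HasDerivAt (deriv (R n : ℂ → ℂ)) (deriv (deriv (R n : ℂ → ℂ)) x) (x : ℂ) :=
    (hdiff.differentiableAt (isOpen_halfPlane.mem_nhds (by simpa using hx))).hasDerivAt
  exact hd.real_of_complex.deriv

/-! ### Vanishing of `Rₙ''` at the triple zeros `k = 1, …, 27n` -/

/-- Pulling one factor `(k - j)` out of `∏_{i=1}^{27n} (k - i)`: `Rₙ(k) = G(k) (k - j)³`.
[cite: Zudilin2004, §8 (8.7)] -/
theorem R_eq_mul_cube (n : ℕ) {j : ℕ} (hj : j ∈ Icc 1 (27 * n)) (k : ℂ) :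
    R n k = (normConst n : ℂ) * (37 * n + 2 * k) * (∏ i ∈ (Icc 1 (27 * n)).erase j, (k - i)) ^ 3 *
      (∏ i ∈ Icc (37 * n + 1) (64 * n), (k + i)) ^ 3 /
      (∏ u ∈ Icc 1 10, ∏ i ∈ Icc ((12 - u) * n) ((25 + u) * n), (k + i)) * (k - j) ^ 3 := by
  unfold R
  rw [← Finset.mul_prod_erase _ _ hj]
  ring

/-- If `G` is holomorphic near `j` then `(G(k)(k-j)³)'' = 0` at `k = j`. [folklore] -/
theorem iteratedDeriv_two_mul_cube_eq_zero {G : ℂ → ℂ} {j : ℂ} {U : Set ℂ} (hU : IsOpen U)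
    (hj : j ∈ U) (hG : DifferentiableOn ℂ G U) :
    iteratedDeriv 2 (fun k ↦ G k * (k - j) ^ 3) j = 0 := by
  rw [iteratedDeriv_succ, iteratedDeriv_one]
  have hG' : DifferentiableOn ℂ (deriv G) U := hG.deriv hU
  have hP : ∀ k : ℂ, HasDerivAt (fun k : ℂ ↦ (k - j) ^ 3) (3 * (k - j) ^ 2) k := by
    intro k
    simpa using ((hasDerivAt_id k).sub_const j).fun_pow 3
  have h1 : ∀ k ∈ U, HasDerivAt (fun k ↦ G k * (k - j) ^ 3)
      (deriv G k * (k - j) ^ 3 + G k * (3 * (k - j) ^ 2)) k := fun k hk ↦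
    ((hG.differentiableAt (hU.mem_nhds hk)).hasDerivAt).mul (hP k)
  have hev : deriv (fun k ↦ G k * (k - j) ^ 3) =ᶠ[𝓝 j]
      fun k ↦ deriv G k * (k - j) ^ 3 + G k * (3 * (k - j) ^ 2) := by
    filter_upwards [hU.mem_nhds hj] with k hk using (h1 k hk).deriv
  rw [hev.deriv_eq]
  have hGj : HasDerivAt G (deriv G j) j := (hG.differentiableAt (hU.mem_nhds hj)).hasDerivAt
  have hG'j : HasDerivAt (deriv G) (deriv (deriv G) j) j :=
    (hG'.differentiableAt (hU.mem_nhds hj)).hasDerivAt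
  have hP2 : HasDerivAt (fun k : ℂ ↦ 3 * (k - j) ^ 2) (3 * (2 * (j - j))) j := by
    simpa using (((hasDerivAt_id j).sub_const j).fun_pow 2).const_mul (3 : ℂ)
  have h2 : HasDerivAt (fun k ↦ deriv G k * (k - j) ^ 3 + G k * (3 * (k - j) ^ 2))
      (deriv (deriv G) j * (j - j) ^ 3 + deriv G j * (3 * (j - j) ^ 2) +
        (deriv G j * (3 * (j - j) ^ 2) + G j * (3 * (2 * (j - j))))) j :=
    (hG'j.mul (hP j)).add (hGj.mul hP2)
  rw [h2.deriv]
  simp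

/-- **`Rₙ''(j) = 0` for `j = 1, …, 27n`** (triple zeros). [cite: Zudilin2004, §8 (8.6)–(8.7)] -/
theorem iteratedDeriv_two_R_eq_zero {n : ℕ} (hn : 1 ≤ n) {j : ℕ} (hj : j ∈ Icc 1 (27 * n)) :
    iteratedDeriv 2 (R n : ℂ → ℂ) (j : ℂ) = 0 := by
  set G : ℂ → ℂ := fun k ↦ (normConst n : ℂ) * (37 * n + 2 * k) *
      (∏ i ∈ (Icc 1 (27 * n)).erase j, (k - i)) ^ 3 *
      (∏ i ∈ Icc (37 * n + 1) (64 * n), (k + i)) ^ 3 /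
      (∏ u ∈ Icc 1 10, ∏ i ∈ Icc ((12 - u) * n) ((25 + u) * n), (k + i)) with hG
  have hR : (R n : ℂ → ℂ) = fun k ↦ G k * (k - j) ^ 3 := funext fun k ↦ R_eq_mul_cube n hj k
  rw [hR]
  refine iteratedDeriv_two_mul_cube_eq_zero isOpen_halfPlane ?_ ?_
  · simp only [Set.mem_setOf_eq, natCast_re]
    have : (1 : ℝ) ≤ j := by exact_mod_cast (mem_Icc.1 hj).1
    linarith
  · intro k hk
    refine DifferentiableAt.differentiableWithinAt ?_
    simp only [hG]
    refine DifferentiableAt.div ?_ ?_ (den_ne_zero hn hk)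
    · refine ((DifferentiableAt.mul ?_ ?_).mul ?_).mul ?_
      · exact differentiableAt_const _
      · fun_prop
      · exact (DifferentiableAt.fun_finsetProd fun i _ ↦ by fun_prop).pow 3
      · exact (DifferentiableAt.fun_finsetProd fun i _ ↦ by fun_prop).pow 3
    · exact DifferentiableAt.fun_finsetProd fun u _ ↦ DifferentiableAt.fun_finsetProd fun i _ ↦ by
        fun_prop

/-! ### Summability and the representation of `Sₙ` -/

/-- Decay of `Rₙ''` on `{re k ≥ 1/2}`: `‖Rₙ''(k)‖ ≤ C''ₙ/(1 + ‖k‖²)`. [folklore] -/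
theorem norm_iteratedDeriv_two_R_le {n : ℕ} (hn : 1 ≤ n) {k : ℂ} (hk : 1 / 2 ≤ k.re) :
    ‖iteratedDeriv 2 (R n : ℂ → ℂ) k‖ ≤
      ((2 : ℕ).factorial * (2 * (1 + (1 / 2 : ℝ) ^ 2) * (8 * |(normConst n : ℝ)| * 64 ^ (162 * n + 1))) /
        (1 / 2 : ℝ) ^ 2) / (1 + ‖k‖ ^ 2) :=
  Literature.Analysis.Complex.norm_iteratedDeriv_le_of_decay (a := -1 / 2) (by norm_num)
    (differentiableOn_R hn) (fun z hz ↦ norm_R_le hn hz) 2 (by linarith)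

/-- The complex series `Σ_{k ≥ 0} Rₙ''(k + 1)` converges absolutely. [folklore] -/
theorem summable_iteratedDeriv_two_R {n : ℕ} (hn : 1 ≤ n) :
    Summable fun k : ℕ ↦ iteratedDeriv 2 (R n : ℂ → ℂ) ((k : ℂ) + 1) := by
  have h := Literature.Analysis.Complex.summable_norm_int_shift (h := iteratedDeriv 2 (R n : ℂ → ℂ))
    (c := 1 / 2) (fun z hz ↦ norm_iteratedDeriv_two_R_le hn hz)
  have hfl : ⌊(1 / 2 : ℝ)⌋ = 0 := by norm_num
  rw [hfl] at h
  refine Summable.of_norm ?_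
  refine h.congr fun k ↦ ?_
  congr 2
  push_cast; ring

/-- `Sₙ` is the real part of half the complex series `Σ_{k ≥ 0} Rₙ''(k + 1)`.
[cite: Zudilin2004, §8 (8.6)] -/
theorem S_eq_re_tsum {n : ℕ} (hn : 1 ≤ n) :
    S n = ((1 / 2 : ℂ) * ∑' k : ℕ, iteratedDeriv 2 (R n : ℂ → ℂ) ((k : ℂ) + 1)).re := by
  unfold S
  rw [Complex.mul_re]
  have h2 : ((1 / 2 : ℂ)).im = 0 := by norm_num
  have h2' : ((1 / 2 : ℂ)).re = 1 / 2 := by norm_num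
  rw [h2, zero_mul, sub_zero, h2', Complex.re_tsum (summable_iteratedDeriv_two_R hn)]
  congr 1
  refine tsum_congr fun k ↦ ?_
  have hx : (-1 / 2 : ℝ) < (k : ℝ) + 1 := by
    have : (0 : ℝ) ≤ k := Nat.cast_nonneg k
    linarith
  rw [iteratedDeriv_two_R_real hn hx]
  push_cast
  rfl

/-- **`Sₙ` as a line integral.** For `n ≥ 1` and an integer `0 ≤ m ≤ 27n`,
`Sₙ = Re [ (iπ²/2) ∫ Rₙ(m + ½ + iy) sinh(πy)/cosh³(πy) dy ]`. (The terms `k ≤ m` of the series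
vanish, and the tail is the Barnes integral over the half-integer line `re k = m + ½`.)
[cite: Zudilin2004, §8 (8.4)–(8.6)] -/
theorem S_eq_re_integral {n : ℕ} (hn : 1 ≤ n) {m : ℕ} (hm : m ≤ 27 * n) :
    S n = ((I * π ^ 2 / 2) * ∫ y : ℝ, R n ((m : ℂ) + 1 / 2 + y * I) *
        ((Real.sinh (π * y) : ℂ) / (Real.cosh (π * y) : ℂ) ^ 3)).re := by
  rw [S_eq_re_tsum hn]
  congr 1
  set T : ℕ → ℂ := fun k ↦ iteratedDeriv 2 (R n : ℂ → ℂ) ((k : ℂ) + 1) with hT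
  have hsum : Summable T := summable_iteratedDeriv_two_R hn
  -- split the series at `m`
  rw [← hsum.sum_add_tsum_nat_add m]
  have hzero : ∑ k ∈ range m, T k = 0 := by
    refine sum_eq_zero fun k hk ↦ ?_
    have hk' := mem_range.1 hk
    have hk1 : k + 1 ∈ Icc 1 (27 * n) := mem_Icc.2 ⟨by omega, by omega⟩
    have := iteratedDeriv_two_R_eq_zero hn hk1
    simp only [hT]
    exact_mod_cast this
  rw [hzero, zero_add]
  -- the tail is the line integral
  have hmhalf : (-1 / 2 : ℝ) < (m : ℤ) + 1 / 2 := by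
    have : (0 : ℝ) ≤ ((m : ℤ) : ℝ) := by exact_mod_cast Int.natCast_nonneg m
    linarith
  have htail := Literature.Analysis.Complex.hasSum_iteratedDeriv_two_div_two_halfInt (m := (m : ℤ))
    hmhalf (differentiableOn_R hn) (fun z hz ↦ norm_R_le hn hz)
  have htail' : HasSum (fun k : ℕ ↦ (1 / 2 : ℂ) * T (k + m))
      ((I * π ^ 2 / 2) * ∫ y : ℝ, R n ((m : ℂ) + 1 / 2 + y * I) *
        ((Real.sinh (π * y) : ℂ) / (Real.cosh (π * y) : ℂ) ^ 3)) := by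
    convert htail using 1
    · funext k
      simp only [hT]
      have hcast : (((k + m : ℕ) : ℂ) + 1) = (((m : ℤ) + 1 + (k : ℤ) : ℤ) : ℂ) := by
        push_cast; ring
      rw [hcast]; ring
    · push_cast; rfl
  rw [← htail'.tsum_eq, tsum_mul_left]

end Zudilin2004

end Literature.NumberTheory.Transcendental
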